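import Summits.CriticalPhenomena.PercolationContinuityZ3.Theorems.PercNearOneGluingNoHeavyQuantConvWindow
import Summits.CriticalPhenomena.PercolationContinuityZ3.Theorems.PercNearOneGluingNoHeavyQuantSliceLawSWHolds
import HarnessLib

/-!
# QUANT lane R8, T-DEC: `ConvClosedT` HOLDS WHEN ONE FACTOR HAS AT MOST ONE LOW ATOM (its DEC datum at ONE well-chosen window layer is a
# datum without light straddlers at the target layer, so the one-sided convolution closure applies)

builds on p205010 (kernel theorem, internal audit signed; external expert review pending)

Support file (`--supports stmt-CriticalPhenomena-4575`), QUANT lane seat prim-quant-census-1 (gen 20), rung R8 of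
`run/shared/lean/prim/quant/LADDER.md`.  Theorems only, standard axioms, no sorries.  Memo `run/shared/lean/prim/quant/prim-quant-census-1/CONV-G20.md` §8.

THE POINT.  The one-sided closure (`lconv_decAtT_of_window_bdecAtT`, census-1 g20; `SliceClosedWindowT` = the typer's `sliceClosedWindowT_holds`)
needs a datum of `μ₂` at the target layer `j` without LIGHT STRADDLERS relative to `M₁` (`BDECAtT`).  If `μ₂` has at most ONE low atom `q` at
`(T₂, j)`, such a datum is READ OFF the plain DEC datum of `μ₂` at the single window layer `J = max(j − M₁, min(j, ⌊q + (T₂ − 2q)/x⌋))` — the layer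
just below the first position whose pair with `q` would be a light straddler (`bdecAtT_of_decAtT_singleLow`): every component of the layer-`J` datum
is re-read at layer `j` — giant pairs of `J` whose `hi ≤ j` become HEAVY credit pairs (`x ≤ g`, and the credit holds because `hi > J` is a light
position for `q`), light credit pairs of `J` do not straddle (a light position `≤ J` is `≤ j − M₁`), heavy credit pairs and points stay what they are;
the single-low hypothesis identifies the `lo` of every charged component with `q`.  Hence **`ConvClosedT` holds whenever one factor has at most one
low atom** (`lconv_decAtT_of_window_singleLow`) — any number of absorbers, any targets; it contains the two-point case.  By census-1 g20's vertex census
(memo §8 (2)) the first laws outside its reach are the three-atom vertices with TWO lows sharing one absorber.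

* **`LawDec.bdecAtT_of_decAtT_singleLow`** — DEC at the layer `J` ⟹ `BDECAtT` at `j`, for a law with at most one `j`-low atom.
* **`LawDec.lconv_decAtT_of_window_singleLow`** — `ConvClosedT` for a second factor with at most one low atom.
* **`LawDec.bdecAtT_of_decAtT_uniformLayer`**, **`LawDec.lconv_decAtT_of_window_uniformLayer`** — the same for several lows sharing ONE separating
  layer `J` (appended).

[this work].  Nothing here is cited as a published result.  The gluing rows served [cite: KozmaNitzan2024, Conjecture 3 (p. 15)]; product measure
[cite: Grimmett1999, §1.3 p. 10].
-/

noncomputable section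

namespace Summit.CriticalPhenomena.PercolationContinuityZ3.Theorems

namespace Quant

open Finset

/-- the two-point law `{lo, hi; g}` (as in `…QuantLawDEC`) -/
local notation3 "TP[" lo ", " hi ", " g ", " h "]" =>
  (g : ℝ) * (if (h : ℕ) = (hi : ℕ) then (1 : ℝ) else 0) + (1 - (g : ℝ)) * (if (h : ℕ) = (lo : ℕ) then (1 : ℝ) else 0)

namespace LawDec

/-! ### From the DEC datum at the layer `J` to a datum without light straddlers at the layer `j` -/

/-- **ONE LAYER SUFFICES FOR A SINGLE LOW.**  Let `0 < x < 1`, `q ≤ J ≤ j`, and let `μ` have at most one `j`-low atom, namely `q`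
(`k ≤ j`, `2k < T`, `μ k > 0 ⟹ k = q`).  Suppose every position `k` with `J < k ≤ j` is LIGHT for `q` (`T − 2q < x(k − q)`) and every light position
`q < k ≤ J` satisfies `k + a ≤ j` (both only asked when `2q < T`).  Then a DEC datum of `μ` at `(T, J)` is a `BDECAtT` datum at `(T, j)` relative to `a`:
components with `g = 1` are points at non-low positions; a giant pair of `J` with `hi ≤ j` is a heavy credit pair at `j` (`x ≤ g`, credit from lightness
of `hi`); a light credit pair of `J` has `hi + a ≤ j`; heavy credit pairs and points are unchanged. [this work] -/
theorem bdecAtT_of_decAtT_singleLow (x T : ℝ) (j J M a q : ℕ) (μ : ℕ → ℝ) (hx0 : 0 < x) (hx1 : x < 1)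
    (hJj : J ≤ j) (hqJ : q ≤ J)
    (hsingle : ∀ k, k ≤ j → 2 * (k : ℝ) < T → 0 < μ k → k = q)
    (C1 : ∀ k, 2 * (q : ℝ) < T → J + 1 ≤ k → k ≤ j → T - 2 * (q : ℝ) < x * ((k : ℝ) - q))
    (C2 : ∀ k, 2 * (q : ℝ) < T → q < k → k ≤ J → T - 2 * (q : ℝ) < x * ((k : ℝ) - q) → k + a ≤ j)
    (hdec : DECAtT x T J M μ) : BDECAtT x T j M a μ := by
  classical
  obtain ⟨ρ, hρ, lam, g, lo, hi, h0, h1, hg, hlohi, hhi, hμ, hval⟩ := hdec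
  -- mass lower bounds from the mixture
  have hmass : ∀ r k, lam r * TP[lo r, hi r, g r, k] ≤ μ k := by
    intro r k
    rw [hμ k]
    refine Finset.single_le_sum (f := fun r' => lam r' * TP[lo r', hi r', g r', k]) (fun r' _ => ?_) (Finset.mem_univ r)
    have := (hg r').1; have := (hg r').2
    have : 0 ≤ 1 - g r' := by linarith
    exact mul_nonneg (h0 r') (by positivity)
  -- a charged position that is a `j`-low is `q`
  have hlo_q : ∀ r, 0 < lam r → g r < 1 → lo r ≤ j → 2 * (lo r : ℝ) < T → lo r = q := by
    intro r hr hg1 hlj hlow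
    refine hsingle (lo r) hlj hlow (lt_of_lt_of_le ?_ (hmass r (lo r)))
    have : 0 ≤ g r * (if lo r = hi r then (1 : ℝ) else 0) := mul_nonneg (hg r).1 (by split_ifs <;> norm_num)
    have : 0 < (1 - g r) * (if lo r = lo r then (1 : ℝ) else 0) := by rw [if_pos rfl, mul_one]; linarith
    nlinarith
  -- the new datum: same components, `lo` replaced by `hi` when `g = 1`
  refine ⟨ρ, hρ, lam, g, fun r => if g r = 1 then hi r else lo r, hi, h0, h1, hg, fun r => ?_, hhi, fun k => ?_, fun r hr => ?_⟩
  · show (if g r = 1 then hi r else lo r) ≤ hi r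
    split_ifs
    · exact le_rfl
    · exact hlohi r
  · rw [hμ k]
    refine Finset.sum_congr rfl fun r _ => ?_
    by_cases h1g : g r = 1
    · simp only [h1g, if_true]; ring
    · simp only [h1g, if_false]
  -- validity at layer j
  have hvr := hval r hr
  by_cases h1g : g r = 1
  · -- a point at `hi r`, which is not a `j`-low
    simp only [h1g, if_true]
    refine Or.inl (Or.inl ⟨rfl, ?_⟩)
    by_cases hgj : j + 1 ≤ hi r
    · exact Or.inr hgj
    · left
      by_contra hT
      push Not at hT
      have hpos : 0 < lam r * TP[lo r, hi r, g r, hi r] := by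
        have e : TP[lo r, hi r, g r, hi r] = 1 := by
          rw [if_pos rfl, h1g]; ring
        rw [e, mul_one]; exact hr
      have hq : hi r = q := hsingle (hi r) (by omega) hT (lt_of_lt_of_le hpos (hmass r (hi r)))
      rcases hvr with ⟨hlh, hss⟩ | ⟨-, hgi, -⟩ | ⟨hlh, hhJ, hcr⟩
      · rcases hss with hss | hss
        · have : (lo r : ℝ) = hi r := by exact_mod_cast hlh
          linarith
        · omega
      · omega
      · rw [if_pos (by rw [h1g]; exact hx1.le), h1g] at hcr
        have : (lo r : ℝ) + 1 ≤ hi r := by exact_mod_cast hlh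
        linarith
  · have hg1 : g r < 1 := lt_of_le_of_ne (hg r).2 h1g
    simp only [h1g, if_false]
    rcases hvr with ⟨hlh, hss⟩ | ⟨hlh, hgi, hxg⟩ | ⟨hlh, hhJ, hcr⟩
    · -- point
      refine Or.inl (Or.inl ⟨hlh, ?_⟩)
      rcases hss with hss | hss
      · exact Or.inl hss
      · by_cases hlj : lo r ≤ j
        · by_cases hT : T ≤ 2 * (lo r : ℝ)
          · exact Or.inl hT
          · push Not at hT
            have := hlo_q r hr hg1 hlj hT
            omega
        · exact Or.inr (by omega)
    · -- giant pair at J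
      by_cases hgj : j + 1 ≤ hi r
      · exact Or.inl (Or.inr (Or.inl ⟨hlh, hgj, hxg⟩))
      · have hhj : hi r ≤ j := by omega
        by_cases hT : T ≤ 2 * (lo r : ℝ)
        · exact Or.inr (Or.inl ⟨hlh, Or.inl hT⟩)
        · push Not at hT
          have hq : lo r = q := hlo_q r hr hg1 (by omega) hT
          have hlow : 2 * (q : ℝ) < T := by rw [← hq]; exact hT
          have hlight := C1 (hi r) hlow hgi hhj
          refine Or.inl (Or.inr (Or.inr ⟨hlh, hhj, hxg, ?_⟩))
          rw [hq]
          have hd : (0 : ℝ) ≤ (hi r : ℝ) - q := by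
            have : q < hi r := by omega
            have : (q : ℝ) < hi r := by exact_mod_cast this
            linarith
          nlinarith [mul_le_mul_of_nonneg_left hxg hd]
    · -- credit pair at J (hi ≤ J ≤ j)
      have hhj : hi r ≤ j := le_trans hhJ hJj
      by_cases hxg : x ≤ g r
      · rw [if_pos hxg] at hcr
        exact Or.inl (Or.inr (Or.inr ⟨hlh, hhj, hxg, hcr⟩))
      · rw [if_neg hxg] at hcr
        push Not at hxg
        by_cases hT : T ≤ 2 * (lo r : ℝ)
        · exact Or.inr (Or.inl ⟨hlh, Or.inl hT⟩)
        · push Not at hT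
          have hq : lo r = q := hlo_q r hr hg1 (by omega) hT
          have hlow : 2 * (q : ℝ) < T := by rw [← hq]; exact hT
          have h1x : 0 < 1 - x := by linarith
          have hd : (0 : ℝ) < (hi r : ℝ) - lo r := by
            have : (lo r : ℝ) < hi r := by exact_mod_cast hlh
            linarith
          -- g > x²: the credit is positive
          have hx2 : x ^ 2 < g r := by
            by_contra hle
            push Not at hle
            have : ((hi r : ℝ) - lo r) * ((g r - x ^ 2) / (1 - x)) ≤ 0 :=
              mul_nonpos_of_nonneg_of_nonpos hd.le (div_nonpos_of_nonpos_of_nonneg (by linarith) h1x.le)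
            linarith
          -- the pair is light: T - 2q < x (hi - q)
          have hlt : (g r - x ^ 2) / (1 - x) < x := by
            rw [div_lt_iff₀ h1x]; nlinarith
          have hlight : T - 2 * (q : ℝ) < x * ((hi r : ℝ) - q) := by
            rw [← hq]
            nlinarith [mul_lt_mul_of_pos_left hlt hd]
          have hbelow := C2 (hi r) hlow (by omega) hhJ hlight
          exact Or.inr (Or.inr ⟨hlh, hbelow, hx2, hxg, hcr⟩)

/-! ### `ConvClosedT` for a factor with at most one low atom -/

/-- **`ConvClosedT` HOLDS WHEN THE SECOND FACTOR HAS AT MOST ONE LOW ATOM.**  For `0 < x < 1`, a probability law `μ₁ ≥ 0` on `{0..M₁}`, a law `μ₂`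
whose only possible `j`-low atom at target `T₂` is `q ≤ j` (`k ≤ j`, `2k < T₂`, `μ₂ k > 0 ⟹ k = q`), and ANY real targets: if `μ₁` is DEC at `T₁` at
every layer `j″ ≤ j` with `j ≤ j″ + M₂` and `μ₂` is DEC at `T₂` at every layer `j″ ≤ j` with `j ≤ j″ + M₁`, then `lconv M₁ M₂ μ₁ μ₂` is DEC at
`(T₁ + T₂, j)` on `{0..M₁+M₂}`.  The layer used for `μ₂` is `J = max(j − M₁, min(j, ⌊q + (T₂ − 2q)/x⌋))` (`bdecAtT_of_decAtT_singleLow`), then the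
one-sided closure `lconv_decAtT_of_window_bdecAtT` with `sliceClosedWindowT_holds`. [this work] -/
theorem lconv_decAtT_of_window_singleLow (x T₁ T₂ : ℝ) (j M₁ M₂ q : ℕ) (μ₁ μ₂ : ℕ → ℝ) (hx0 : 0 < x) (hx1 : x < 1)
    (h10 : ∀ k, 0 ≤ μ₁ k) (h1M : ∀ k, M₁ < k → μ₁ k = 0) (h11 : ∑ k ∈ Finset.range (M₁ + 1), μ₁ k = 1)
    (hqj : q ≤ j) (hsingle : ∀ k, k ≤ j → 2 * (k : ℝ) < T₂ → 0 < μ₂ k → k = q)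
    (hwin₁ : ∀ j'', j'' ≤ j → j ≤ j'' + M₂ → DECAtT x T₁ j'' M₁ μ₁)
    (hwin₂ : ∀ j'', j'' ≤ j → j ≤ j'' + M₁ → DECAtT x T₂ j'' M₂ μ₂) :
    DECAtT x (T₁ + T₂) j (M₁ + M₂) (lconv M₁ M₂ μ₁ μ₂) := by
  refine lconv_decAtT_of_window_bdecAtT sliceClosedWindowT_holds x T₁ T₂ j M₁ M₂ μ₁ μ₂ hx0 hx1 h10 h1M h11 hwin₁ ?_
  by_cases hlow : 2 * (q : ℝ) < T₂
  swap
  · -- `q` is not low, so there is no low atom at all: the layer `j` itself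
    exact bdecAtT_of_decAtT_singleLow x T₂ j j M₂ M₁ q μ₂ hx0 hx1 le_rfl hqj hsingle
      (fun k hl _ _ => absurd hl hlow) (fun k hl _ _ _ => absurd hl hlow) (hwin₂ j le_rfl (Nat.le_add_right _ _))
  · -- the layer just below the first light straddling position
    have hy0 : 0 ≤ (q : ℝ) + (T₂ - 2 * (q : ℝ)) / x := by
      have : 0 ≤ (T₂ - 2 * (q : ℝ)) / x := div_nonneg (by linarith) hx0.le
      positivity
    have hqy : (q : ℝ) ≤ (q : ℝ) + (T₂ - 2 * (q : ℝ)) / x := by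
      have : 0 ≤ (T₂ - 2 * (q : ℝ)) / x := div_nonneg (by linarith) hx0.le
      linarith
    have hqf : q ≤ ⌊(q : ℝ) + (T₂ - 2 * (q : ℝ)) / x⌋₊ := Nat.le_floor hqy
    have hJj : max (j - M₁) (min j ⌊(q : ℝ) + (T₂ - 2 * (q : ℝ)) / x⌋₊) ≤ j :=
      max_le (Nat.sub_le j M₁) (min_le_left j _)
    have hqJ : q ≤ max (j - M₁) (min j ⌊(q : ℝ) + (T₂ - 2 * (q : ℝ)) / x⌋₊) :=
      le_trans (le_min hqj hqf) (le_max_right _ _)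
    have hJw : j ≤ max (j - M₁) (min j ⌊(q : ℝ) + (T₂ - 2 * (q : ℝ)) / x⌋₊) + M₁ := by
      have := le_max_left (j - M₁) (min j ⌊(q : ℝ) + (T₂ - 2 * (q : ℝ)) / x⌋₊)
      omega
    refine bdecAtT_of_decAtT_singleLow x T₂ j _ M₂ M₁ q μ₂ hx0 hx1 hJj hqJ hsingle ?_ ?_ (hwin₂ _ hJj hJw)
    · -- positions above `J` (and `≤ j`) are light for `q`
      intro k _ hk hkj
      have h1 : min j ⌊(q : ℝ) + (T₂ - 2 * (q : ℝ)) / x⌋₊ ≤ max (j - M₁) (min j ⌊(q : ℝ) + (T₂ - 2 * (q : ℝ)) / x⌋₊) :=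
        le_max_right _ _
      have hfl : ⌊(q : ℝ) + (T₂ - 2 * (q : ℝ)) / x⌋₊ < k := by omega
      have hyk : (q : ℝ) + (T₂ - 2 * (q : ℝ)) / x < k := (Nat.floor_lt hy0).1 hfl
      have : (T₂ - 2 * (q : ℝ)) / x < (k : ℝ) - q := by linarith
      have := (div_lt_iff₀ hx0).1 this
      linarith
    · -- light positions `≤ J` are below the straddle line
      intro k _ hqk hkJ hlight
      rcases le_max_iff.1 hkJ with h | h
      · omega
      · exfalso
        have h2 : k ≤ ⌊(q : ℝ) + (T₂ - 2 * (q : ℝ)) / x⌋₊ := le_trans h (min_le_right _ _)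
        have hky : (k : ℝ) ≤ (q : ℝ) + (T₂ - 2 * (q : ℝ)) / x := (Nat.le_floor_iff hy0).1 h2
        have : (k : ℝ) - q ≤ (T₂ - 2 * (q : ℝ)) / x := by linarith
        have := (le_div_iff₀ hx0).1 this
        linarith

/-! ### Several lows with a UNIFORM layer -/

/-- **ONE LAYER SUFFICES FOR SEVERAL LOWS WITH A UNIFORM LIGHT THRESHOLD.**  As `bdecAtT_of_decAtT_singleLow`, for a law with any number of
`j`-low atoms, provided ONE layer `J ≤ j` lies above every low atom and satisfies, for EVERY low atom `q` (`q ≤ j`, `2q < T`, `μ q > 0`): every position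
`k` with `J < k ≤ j` is light for `q` (`T − 2q < x(k − q)`), and every light position `q < k ≤ J` has `k + a ≤ j`.  Then a DEC datum at `(T, J)` is a
`BDECAtT` datum at `(T, j)` relative to `a` (same re-reading of the components; the `lo` of a charged component is a low atom of positive mass).
The light threshold `q + (T − 2q)/x` decreases in `q`, so the first condition is governed by the deepest low and the second by the shallowest.
[this work] -/
theorem bdecAtT_of_decAtT_uniformLayer (x T : ℝ) (j J M a : ℕ) (μ : ℕ → ℝ) (hx0 : 0 < x) (hx1 : x < 1) (hJj : J ≤ j)
    (hlowJ : ∀ q, q ≤ j → 2 * (q : ℝ) < T → 0 < μ q → q ≤ J)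
    (C1 : ∀ q k, q ≤ j → 2 * (q : ℝ) < T → 0 < μ q → J + 1 ≤ k → k ≤ j → T - 2 * (q : ℝ) < x * ((k : ℝ) - q))
    (C2 : ∀ q k, q ≤ j → 2 * (q : ℝ) < T → 0 < μ q → q < k → k ≤ J → T - 2 * (q : ℝ) < x * ((k : ℝ) - q) → k + a ≤ j)
    (hdec : DECAtT x T J M μ) : BDECAtT x T j M a μ := by
  classical
  obtain ⟨ρ, hρ, lam, g, lo, hi, h0, h1, hg, hlohi, hhi, hμ, hval⟩ := hdec
  -- mass lower bounds from the mixture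
  have hmass : ∀ r k, lam r * TP[lo r, hi r, g r, k] ≤ μ k := by
    intro r k
    rw [hμ k]
    refine Finset.single_le_sum (f := fun r' => lam r' * TP[lo r', hi r', g r', k]) (fun r' _ => ?_) (Finset.mem_univ r)
    have := (hg r').1; have := (hg r').2
    have : 0 ≤ 1 - g r' := by linarith
    exact mul_nonneg (h0 r') (by positivity)
  -- the `lo` of a charged component with `g < 1` has positive mass
  have hlo_pos : ∀ r, 0 < lam r → g r < 1 → 0 < μ (lo r) := by
    intro r hr hg1
    refine lt_of_lt_of_le ?_ (hmass r (lo r))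
    have : 0 ≤ g r * (if lo r = hi r then (1 : ℝ) else 0) := mul_nonneg (hg r).1 (by split_ifs <;> norm_num)
    have : 0 < (1 - g r) * (if lo r = lo r then (1 : ℝ) else 0) := by rw [if_pos rfl, mul_one]; linarith
    nlinarith
  refine ⟨ρ, hρ, lam, g, fun r => if g r = 1 then hi r else lo r, hi, h0, h1, hg, fun r => ?_, hhi, fun k => ?_, fun r hr => ?_⟩
  · show (if g r = 1 then hi r else lo r) ≤ hi r
    split_ifs
    · exact le_rfl
    · exact hlohi r
  · rw [hμ k]
    refine Finset.sum_congr rfl fun r _ => ?_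
    by_cases h1g : g r = 1
    · simp only [h1g, if_true]; ring
    · simp only [h1g, if_false]
  have hvr := hval r hr
  by_cases h1g : g r = 1
  · -- a point at `hi r`, which is not a `j`-low
    simp only [h1g, if_true]
    refine Or.inl (Or.inl ⟨rfl, ?_⟩)
    by_cases hgj : j + 1 ≤ hi r
    · exact Or.inr hgj
    · left
      by_contra hT
      push Not at hT
      have hpos : 0 < lam r * TP[lo r, hi r, g r, hi r] := by
        have e : TP[lo r, hi r, g r, hi r] = 1 := by
          rw [if_pos rfl, h1g]; ring
        rw [e, mul_one]; exact hr
      have hJ' : hi r ≤ J := hlowJ (hi r) (by omega) hT (lt_of_lt_of_le hpos (hmass r (hi r)))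
      rcases hvr with ⟨hlh, hss⟩ | ⟨-, hgi, -⟩ | ⟨hlh, hhJ, hcr⟩
      · rcases hss with hss | hss
        · have : (lo r : ℝ) = hi r := by exact_mod_cast hlh
          linarith
        · omega
      · omega
      · rw [if_pos (by rw [h1g]; exact hx1.le), h1g] at hcr
        have : (lo r : ℝ) + 1 ≤ hi r := by exact_mod_cast hlh
        linarith
  · have hg1 : g r < 1 := lt_of_le_of_ne (hg r).2 h1g
    simp only [h1g, if_false]
    rcases hvr with ⟨hlh, hss⟩ | ⟨hlh, hgi, hxg⟩ | ⟨hlh, hhJ, hcr⟩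
    · -- point
      refine Or.inl (Or.inl ⟨hlh, ?_⟩)
      rcases hss with hss | hss
      · exact Or.inl hss
      · by_cases hlj : lo r ≤ j
        · by_cases hT : T ≤ 2 * (lo r : ℝ)
          · exact Or.inl hT
          · push Not at hT
            have := hlowJ (lo r) hlj hT (hlo_pos r hr hg1)
            omega
        · exact Or.inr (by omega)
    · -- giant pair at J
      by_cases hgj : j + 1 ≤ hi r
      · exact Or.inl (Or.inr (Or.inl ⟨hlh, hgj, hxg⟩))
      · have hhj : hi r ≤ j := by omega
        by_cases hT : T ≤ 2 * (lo r : ℝ)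
        · exact Or.inr (Or.inl ⟨hlh, Or.inl hT⟩)
        · push Not at hT
          have hlight := C1 (lo r) (hi r) (by omega) hT (hlo_pos r hr hg1) hgi hhj
          refine Or.inl (Or.inr (Or.inr ⟨hlh, hhj, hxg, ?_⟩))
          have hd : (0 : ℝ) ≤ (hi r : ℝ) - lo r := by
            have : (lo r : ℝ) < hi r := by exact_mod_cast hlh
            linarith
          nlinarith [mul_le_mul_of_nonneg_left hxg hd]
    · -- credit pair at J (hi ≤ J ≤ j)
      have hhj : hi r ≤ j := le_trans hhJ hJj
      by_cases hxg : x ≤ g r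
      · rw [if_pos hxg] at hcr
        exact Or.inl (Or.inr (Or.inr ⟨hlh, hhj, hxg, hcr⟩))
      · rw [if_neg hxg] at hcr
        push Not at hxg
        by_cases hT : T ≤ 2 * (lo r : ℝ)
        · exact Or.inr (Or.inl ⟨hlh, Or.inl hT⟩)
        · push Not at hT
          have h1x : 0 < 1 - x := by linarith
          have hd : (0 : ℝ) < (hi r : ℝ) - lo r := by
            have : (lo r : ℝ) < hi r := by exact_mod_cast hlh
            linarith
          have hx2 : x ^ 2 < g r := by
            by_contra hle
            push Not at hle
            have : ((hi r : ℝ) - lo r) * ((g r - x ^ 2) / (1 - x)) ≤ 0 :=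
              mul_nonpos_of_nonneg_of_nonpos hd.le (div_nonpos_of_nonpos_of_nonneg (by linarith) h1x.le)
            linarith
          have hlt : (g r - x ^ 2) / (1 - x) < x := by
            rw [div_lt_iff₀ h1x]; nlinarith
          have hlight : T - 2 * (lo r : ℝ) < x * ((hi r : ℝ) - lo r) := by
            nlinarith [mul_lt_mul_of_pos_left hlt hd]
          have hbelow := C2 (lo r) (hi r) (by omega) hT (hlo_pos r hr hg1) hlh hhJ hlight
          exact Or.inr (Or.inr ⟨hlh, hbelow, hx2, hxg, hcr⟩)

/-- **`ConvClosedT` HOLDS WHEN THE SECOND FACTOR HAS A UNIFORM LAYER.**  For `0 < x < 1`, a probability law `μ₁ ≥ 0` on `{0..M₁}`, any law `μ₂`, ANY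
real targets and a layer `J ≤ j` with `j ≤ J + M₁` lying above every `j`-low atom of `μ₂` and satisfying the two conditions of
`bdecAtT_of_decAtT_uniformLayer` relative to `M₁`: if `μ₁` is DEC at `T₁` on the window `[j − M₂, j]` and `μ₂` is DEC at `(T₂, J)`, then
`lconv M₁ M₂ μ₁ μ₂` is DEC at `(T₁ + T₂, j)`.  Only ONE layer of `μ₂`'s window is used. [this work] -/
theorem lconv_decAtT_of_window_uniformLayer (x T₁ T₂ : ℝ) (j J M₁ M₂ : ℕ) (μ₁ μ₂ : ℕ → ℝ) (hx0 : 0 < x) (hx1 : x < 1)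
    (h10 : ∀ k, 0 ≤ μ₁ k) (h1M : ∀ k, M₁ < k → μ₁ k = 0) (h11 : ∑ k ∈ Finset.range (M₁ + 1), μ₁ k = 1)
    (hJj : J ≤ j)
    (hlowJ : ∀ q, q ≤ j → 2 * (q : ℝ) < T₂ → 0 < μ₂ q → q ≤ J)
    (C1 : ∀ q k, q ≤ j → 2 * (q : ℝ) < T₂ → 0 < μ₂ q → J + 1 ≤ k → k ≤ j → T₂ - 2 * (q : ℝ) < x * ((k : ℝ) - q))
    (C2 : ∀ q k, q ≤ j → 2 * (q : ℝ) < T₂ → 0 < μ₂ q → q < k → k ≤ J → T₂ - 2 * (q : ℝ) < x * ((k : ℝ) - q) → k + M₁ ≤ j)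
    (hwin₁ : ∀ j'', j'' ≤ j → j ≤ j'' + M₂ → DECAtT x T₁ j'' M₁ μ₁)
    (hdec₂ : DECAtT x T₂ J M₂ μ₂) :
    DECAtT x (T₁ + T₂) j (M₁ + M₂) (lconv M₁ M₂ μ₁ μ₂) :=
  lconv_decAtT_of_window_bdecAtT sliceClosedWindowT_holds x T₁ T₂ j M₁ M₂ μ₁ μ₂ hx0 hx1 h10 h1M h11 hwin₁
    (bdecAtT_of_decAtT_uniformLayer x T₂ j J M₂ M₁ μ₂ hx0 hx1 hJj hlowJ C1 C2 hdec₂)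

end LawDec

end Quant

end Summit.CriticalPhenomena.PercolationContinuityZ3.Theorems
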